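import Literature.NumberTheory.EllipticCurves.ShimuraCurveHeegnerPointKolyvagin
import Literature.NumberTheory.Automorphic.ShimuraCurveRibetTakahashiComponentPackage
import Literature.NumberTheory.EllipticCurves.Rank1Residual.Predicates
import Summits.BirchSwinnertonDyer.Rank1Residual.X11b.RungK2Leaves
import Summits.BirchSwinnertonDyer.BirchSwinnertonDyer.Theses.ClassRecordThree

/-! BC3 birth skeleton v5 (= registered v4 e3a1e24d with ONE change: the plan-only BC5 rung stub now carries the three published-fact binders `gross_zagier` ∕ `kolyvagin` ∕ `MatarNekovar2019.thm03_padicValNat_card_sha_le_of_irreducible` — conjuncts 1, 2, 19 of the routes' `PublishedInputsThree` ∕ `PublishedInputsKolyThree` — so that it is closable BY NAME by `Theorems.ShimuraKolyvaginRungSEmpty.stub_rung_orderBound_SEmptyAtThree_of_published` (p448259); the two image-regime stubs, `Statement.*`, `_of` and `_proof` are byte-identical to v4). REGISTERED FORM, concludes the route decl BY NAME for crux `ShimuraKolyvaginOrderBoundAtThree` = item stmt-BirchSwinnertonDyer-19616: two image-regime stubs (SHIM-T1 §7.3 transport: Kolyvagin–McCallum–Cha structure argument on X_{N⁺,N⁻}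 via Nekovář 2007 §4 + (R1)(R2) local triviality) + plan-only BC5 rung (S = ∅ = X₀(N): PRINTED, Cha 2005 Thm 21 / MN19 0.3+§0.11, modulo X_{1,N} = X₀(N)); `_of` by cases on Surj W 3; sorries ONLY in stub_*. -/

noncomputable section

open scoped Classical

namespace Summit.BirchSwinnertonDyer.BirchSwinnertonDyer.Cruxes.ShimuraKolyvaginOrderBoundAtThree.Birth

open NumberField CongruenceSubgroup Literature.NumberTheory.Automorphic
  Literature.NumberTheory.EllipticCurves.ModularForms
  Literature.NumberTheory.EllipticCurves

/-! The crux decl is the ROUTE decl `Summit.BirchSwinnertonDyer.BirchSwinnertonDyer.Theses.ClassRecordThree.ShimuraKolyvaginOrderBoundAtThree`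
(item stmt-BirchSwinnertonDyer-19616, rev 13; the KolyvaginRoadThree decl of the same item has the identical text). -/

/-- stub (surjective mod-3 image): KL89/91 + KL §7 transport need a JACOBIAN parametrisation and p ∤ N; at 3 ∣ N⁺ the (R1)+(R2) local conditions at v ∣ 3 are the new input. -/
theorem stub_orderBound_surjAtThree :
  ∀ (W : WeierstrassCurve ℚ) [W.IsElliptic] [W.IsGloballyMinimal] (p : ℕ) [Fact p.Prime]
    (N : ℕ) [NeZero N] (K : Type) [Field K] [NumberField K] (S : Finset ℕ)
    (Dt : ModularParametrizationData W N)
    (X : ShimuraCurveData (∏ q ∈ S, q) (N / ∏ q ∈ S, q))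
    (W' : WeierstrassCurve ℚ) [W'.IsElliptic] (P₀ : ShimuraParametrizationData X W'),
    W.conductorNorm ℤ = N → Literature.NumberTheory.EllipticCurves.Rank1Residual.Surj W 3 → p ≠ 2 → W.HasIrreducibleModPGaloisRep p →
    IsImaginaryQuadratic K → Even S.card →
    (∀ ℓ ∈ S, ℓ.Prime ∧ ℓ ∣ N ∧ ¬ ℓ ^ 2 ∣ N ∧
      ((Ideal.span {(ℓ : ℤ)}).primesOver (𝓞 K)).ncard = 1 ∧ ¬ (ℓ : ℤ) ∣ NumberField.discr K) →
    (∀ ℓ : ℕ, ℓ.Prime → ℓ ∣ N → ℓ ∉ S → ((Ideal.span {(ℓ : ℤ)}).primesOver (𝓞 K)).ncard = 2) →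
    ((Ideal.span {(p : ℤ)}).primesOver (𝓞 K)).ncard = 2 →
    P₀.IsMinimalFor W →
    p ∣ N → p = 3 →
    ∀ (P : (W.baseChange K).toAffine.Point) (degS : ℕ), 0 < degS →
      padicValNat p degS = padicValNat p P₀.deg →
      LDerivEK W K =
        8 * (Real.pi : ℂ) ^ 2 * peterssonProduct (Gamma0 N) 2 Dt.f Dt.f /
            ((((Units.torsionOrder K : ℝ) / 2) ^ 2 * √|(NumberField.discr K : ℝ)| : ℝ) : ℂ) *
          ((P.canonicalHeight : ℂ) / (degS : ℂ)) →
      ¬ IsOfFinAddOrder P →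
        Nat.card (AddCommGroup.primaryComponent (W.baseChange K).sha p) ≤
          p ^ (2 * padicValNat p (AddSubgroup.zmultiples P).index) := by
  sorry

/-- stub (irreducible non-surjective mod-3 image): Cha 2005 §5 / MN19 on X₀(N); nothing printed on X_{N⁺,N⁻} with 3 ∣ N⁺ (D-AUDIT Table C). -/
theorem stub_orderBound_irredNonSurjAtThree :
  ∀ (W : WeierstrassCurve ℚ) [W.IsElliptic] [W.IsGloballyMinimal] (p : ℕ) [Fact p.Prime]
    (N : ℕ) [NeZero N] (K : Type) [Field K] [NumberField K] (S : Finset ℕ)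
    (Dt : ModularParametrizationData W N)
    (X : ShimuraCurveData (∏ q ∈ S, q) (N / ∏ q ∈ S, q))
    (W' : WeierstrassCurve ℚ) [W'.IsElliptic] (P₀ : ShimuraParametrizationData X W'),
    W.conductorNorm ℤ = N → ¬ Literature.NumberTheory.EllipticCurves.Rank1Residual.Surj W 3 → p ≠ 2 → W.HasIrreducibleModPGaloisRep p →
    IsImaginaryQuadratic K → Even S.card →
    (∀ ℓ ∈ S, ℓ.Prime ∧ ℓ ∣ N ∧ ¬ ℓ ^ 2 ∣ N ∧
      ((Ideal.span {(ℓ : ℤ)}).primesOver (𝓞 K)).ncard = 1 ∧ ¬ (ℓ : ℤ) ∣ NumberField.discr K) →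
    (∀ ℓ : ℕ, ℓ.Prime → ℓ ∣ N → ℓ ∉ S → ((Ideal.span {(ℓ : ℤ)}).primesOver (𝓞 K)).ncard = 2) →
    ((Ideal.span {(p : ℤ)}).primesOver (𝓞 K)).ncard = 2 →
    P₀.IsMinimalFor W →
    p ∣ N → p = 3 →
    ∀ (P : (W.baseChange K).toAffine.Point) (degS : ℕ), 0 < degS →
      padicValNat p degS = padicValNat p P₀.deg →
      LDerivEK W K =
        8 * (Real.pi : ℂ) ^ 2 * peterssonProduct (Gamma0 N) 2 Dt.f Dt.f /
            ((((Units.torsionOrder K : ℝ) / 2) ^ 2 * √|(NumberField.discr K : ℝ)| : ℝ) : ℂ) *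
          ((P.canonicalHeight : ℂ) / (degS : ℂ)) →
      ¬ IsOfFinAddOrder P →
        Nat.card (AddCommGroup.primaryComponent (W.baseChange K).sha p) ≤
          p ^ (2 * padicValNat p (AddSubgroup.zmultiples P).index) := by
  sorry

/-- plan-only BC5 rung (S = ∅, N⁻ = 1, the modular curve): PRINTED for X₀(N) at p = 3 ∣ N split in K, E[3] irreducible (Cha 2005 Thm 21; MN19 Thm 0.3 + §0.11 — d_K ∉ {−3, −4} is automatic from 3 split), MODULO the three published named facts it rests on, displayed as binders (conjuncts 1, 2, 19 of `PublishedInputsThree` ∕ of `PublishedInputsKolyThree.1`; none has a `_holds`): Gross–Zagier, Kolyvagin (rank one + Ш finite), Matar–Nekovář 2019 Thm 0.3. With these binders the stub is EXACTLY the type of the landed theorem `Summit.BirchSwinnertonDyer.BirchSwinnertonDyer.Theorems.ShimuraKolyvaginRungSEmpty.stub_rung_orderBound_SEmptyAtThree_of_published` (p448259 ✓; index transfer y_K ↦ displayed P proved there); outside S's known regime (no printed p-part of BSD at p = 3 ∥ N). Not used by `_of`. -/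
theorem stub_rung_orderBound_SEmptyAtThree
    (hGZ : ∀ (N : ℕ) [NeZero N] (W : WeierstrassCurve ℚ) (K : Type) [Field K] [NumberField K],
      gross_zagier N W K)
    (hKol : ∀ (N : ℕ) [NeZero N] (W : WeierstrassCurve ℚ) (K : Type) [Field K] [NumberField K],
      kolyvagin N W K)
    (hMN : ∀ (N : ℕ) [NeZero N] (W : WeierstrassCurve ℚ) (K : Type) [Field K] [NumberField K],
      MatarNekovar2019.thm03_padicValNat_card_sha_le_of_irreducible N W K) :
  ∀ (W : WeierstrassCurve ℚ) [W.IsElliptic] [W.IsGloballyMinimal] (p : ℕ) [Fact p.Prime]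
    (N : ℕ) [NeZero N] (K : Type) [Field K] [NumberField K] (S : Finset ℕ)
    (Dt : ModularParametrizationData W N)
    (X : ShimuraCurveData (∏ q ∈ S, q) (N / ∏ q ∈ S, q))
    (W' : WeierstrassCurve ℚ) [W'.IsElliptic] (P₀ : ShimuraParametrizationData X W'),
    W.conductorNorm ℤ = N → S = ∅ → p ≠ 2 → W.HasIrreducibleModPGaloisRep p →
    IsImaginaryQuadratic K → Even S.card →
    (∀ ℓ ∈ S, ℓ.Prime ∧ ℓ ∣ N ∧ ¬ ℓ ^ 2 ∣ N ∧
      ((Ideal.span {(ℓ : ℤ)}).primesOver (𝓞 K)).ncard = 1 ∧ ¬ (ℓ : ℤ) ∣ NumberField.discr K) →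
    (∀ ℓ : ℕ, ℓ.Prime → ℓ ∣ N → ℓ ∉ S → ((Ideal.span {(ℓ : ℤ)}).primesOver (𝓞 K)).ncard = 2) →
    ((Ideal.span {(p : ℤ)}).primesOver (𝓞 K)).ncard = 2 →
    P₀.IsMinimalFor W →
    p ∣ N → p = 3 →
    ∀ (P : (W.baseChange K).toAffine.Point) (degS : ℕ), 0 < degS →
      padicValNat p degS = padicValNat p P₀.deg →
      LDerivEK W K =
        8 * (Real.pi : ℂ) ^ 2 * peterssonProduct (Gamma0 N) 2 Dt.f Dt.f /
            ((((Units.torsionOrder K : ℝ) / 2) ^ 2 * √|(NumberField.discr K : ℝ)| : ℝ) : ℂ) *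
          ((P.canonicalHeight : ℂ) / (degS : ℂ)) →
      ¬ IsOfFinAddOrder P →
        Nat.card (AddCommGroup.primaryComponent (W.baseChange K).sha p) ≤
          p ^ (2 * padicValNat p (AddSubgroup.zmultiples P).index) := by
  sorry

/-! ## Stub statements by name -/

namespace Statement

/-- Statement of `stub_orderBound_surjAtThree`. -/
abbrev stub_orderBound_surjAtThree : Prop := type_of% @Birth.stub_orderBound_surjAtThree
/-- Statement of `stub_orderBound_irredNonSurjAtThree`. -/
abbrev stub_orderBound_irredNonSurjAtThree : Prop := type_of% @Birth.stub_orderBound_irredNonSurjAtThree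
/-- Statement of `stub_rung_orderBound_SEmptyAtThree` (plan-only BC5 rung WITH its three published-fact binders; not used by `ShimuraKolyvaginOrderBoundAtThree_of`). -/
abbrev stub_rung_orderBound_SEmptyAtThree : Prop := type_of% @Birth.stub_rung_orderBound_SEmptyAtThree

end Statement

/-! ## The composition (sorry-free): the two image-regime stub STATEMENTS imply the crux, BY NAME -/

theorem ShimuraKolyvaginOrderBoundAtThree_of (hS : Statement.stub_orderBound_surjAtThree)
    (hN : Statement.stub_orderBound_irredNonSurjAtThree) :
    Summit.BirchSwinnertonDyer.BirchSwinnertonDyer.Theses.ClassRecordThree.ShimuraKolyvaginOrderBoundAtThree := by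
  intro W _ _ p _ N _ K _ _ S Dt X W' _ P₀ hcond
  by_cases hs : Literature.NumberTheory.EllipticCurves.Rank1Residual.Surj W 3
  · exact hS W p N K S Dt X W' P₀ hcond hs
  · exact hN W p N K S Dt X W' P₀ hcond hs

/-- The crux along this line, MODULO exactly the two registered image-regime stubs (sorries live only in `stub_*`). -/
theorem ShimuraKolyvaginOrderBoundAtThree_proof :
    Summit.BirchSwinnertonDyer.BirchSwinnertonDyer.Theses.ClassRecordThree.ShimuraKolyvaginOrderBoundAtThree :=
  ShimuraKolyvaginOrderBoundAtThree_of stub_orderBound_surjAtThree stub_orderBound_irredNonSurjAtThree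

end Summit.BirchSwinnertonDyer.BirchSwinnertonDyer.Cruxes.ShimuraKolyvaginOrderBoundAtThree.Birth

end
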